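/-
Copyright (c) 2026 the pub-hodgecm-mathlib formalisation cell (harness21).  Prover seat hodgecm-mathlib-LH3-p03 (g6): LH3 «Transf» road, letter L3′ forward half,
the FINAL PAYER of the (J)-H chain (dealer LH3-plan (g4) RULING #22; spec LH3-p01 (g5) `JH-SPEC.v2.md`; binder of record LH3-p01 (g5)).
-/
import Literature.NumberTheory.Rogawski1990.ArchBouazizJumpStOrbFamHOfTwoChart      -- ★ (JH-asm) p851426 (this seat)
import Literature.NumberTheory.Rogawski1990.ArchBouazizTwoChartDescent             -- ★ (JH-desc) p851450 (LH3-p01 (g5)): `exists_twoChart_descent_of_representation`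
import Literature.NumberTheory.Rogawski1990.ArchBouazizTwoChartLeavesPos            -- ★ (JH-A-pos) p851452 (LH10-p02): `exists_twoChart_placeLeaves_stOrbFamH_model_pos`; brings ★ (JH-A) p851404
import Literature.NumberTheory.Rogawski1990.ArchBouazizSplitWallRepresentation      -- ★ (JH-B) p851416 (LH10-p01)
import Literature.NumberTheory.Automorphic.ArchEndoscopicSplitLeafHalfChart         -- ★ (JH-A′) p851422 (LH10-p02)
import Literature.NumberTheory.Rogawski1990.ArchSmoothAmbientLift                   -- ★ `ArchSmooth₂.exists_contDiff`
import Literature.NumberTheory.Automorphic.ArchRankOneSplitIwasawa                  -- ★ FILE 1: rotation circle `K`, `exists_rotLift_mul_mem_borelU`, `isHaarMeasure_map_rotLift`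
import Literature.NumberTheory.Automorphic.ArchEndoscopicChartSplitDock             -- ★ `endoBlockAt_eq_mk_hypBlockGL`, `chartTorusHLoc_eq_torusU`
import Literature.NumberTheory.Automorphic.ArchEndoscopicChartOrbLocal              -- ★ `chartHaarHLoc`, `isHaarMeasure_chartHaarHLoc`, `isInvInvariant_chartHaarHLoc`
import HarnessLib

/-!
# LETTER L3′, FORWARD HALF — PAID: `∃ jcH ≠ 0, ∀ fH ∈ C_c^∞(H_∞), stOrbFamH L νH fH ∈ ArchBouazizSpaceH jcH` (Bouaziz 1994 Thm. 6.2.1 (i), forward inclusion; Shelstad 1979 Thm. 4.7)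

Topic `NumberTheory/Rogawski1990`; namespace `Literature.NumberTheory.Rogawski1990`.  THEOREMS ONLY (no `def`, no instance, no notation beyond the local `Φ₂[L]` abbreviation, no axiom,
no named fact, no `sorry`); kernel lane `--kind proof --supports stmt-HodgeConjecture-24833`.  Cell `pub/hodgecm-mathlib`, crux H413 (`stmt-HodgeConjecture-24833`), F0∕P3c line LH3
(closer stub `stub_N9`, leaf `F0_P3c_StubN9Direct`), letter L3′ `stub_N9bouazizSurjective`, v10 organ **`BouazizForwardStatement`** (RULING #22, LH3-plan (g4) 2026-09-02T12:30:32Z):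
`∀ L … νH …, ∃ jcH, (∀ S w, w ∉ S → jcH S w ≠ 0) ∧ ∀ fH, ArchSmooth₂ L fH → ArchBouazizSpaceH jcH (stOrbFamH L νH fH)` — PAID here by the bare name
**`exists_archBouazizSpaceH_stOrbFamH_leaf (L) (νH)`** (leaf frame: ONE Borel σ-algebra on `H_∞`).

THE (J)-H CHAIN (all ★, assembled here; JH-SPEC v2 of LH3-p01 (g5)).  Per wall `(S, w₀)`, `w₀ ∉ S`, on the rank-one carrier `U(σ_{w₀}Φ₂) = archLocal L 2 Φ₂ w₀` read in ★ 2b∕4d's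
`J`-tokens (`hJ : σ_{w₀}Φ₂ = Φ₂ ⊗ ℂ` by ★ `antidiagOne_map` + ★ `StdForm.over_antidiagonal_eq`):
* ★ (JH-A-pos) `exists_twoChart_placeLeaves_stOrbFamH_model_pos` (LH10-p02 (g7)): Haar measures `ν_w`, POSITIVE constants `K₀, K₀′`, the two families of per-place leaves
  `(Λ_w, Z_w)` ∕ `(Λ′_w, Z′_w)` (compact ∕ split at `w₀`, shared off `w₀`), `C′ ≠ 0` and the quotient identity of the split leaf — ALL BEFORE the test function — and, per `fH`,
  the flip-sum MODELS (c) of `stOrbFamH L νH fH S` and `stOrbFamH L νH fH (insert w₀ S)`;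
* the Iwasawa datum on `U(J)` (★ FILE 1 `ArchRankOneSplitIwasawa`: the rotation circle `K = {k_s}`, `U(J) = K·B`, its Haar measure; `μ_N` Haar on `N`);
* ★ (JH-A′) `exists_integral_leaf_eq_smul_integral_halfChart` (LH10-p02 (g7)): the split leaf in `K × N` half-chart currency, ONE `C ≠ 0` (recipe: instances `jM jB jLC jSC jMq jBq` named,
  `T′ := chartTorusHLoc`, ★ `chartTorusHLoc_eq_torusU`, ★ `chartHaarHLoc`, `γ′ := endoBlockAt (insert w₀ S) w₀`, ★ `endoBlockAt_eq_mk_hypBlockGL`);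
* ★ (JH-B) `exists_wallSet_representation_twoChart` (LH10-p01 (g5)) at slab shift `m := 0`: the wall-set representation `hrep` of the pi-leaf integrals on both charts, per `fH`
  (`Θ` from ★ `ArchSmooth₂.exists_contDiff`);
* ★ (JH-desc) `exists_twoChart_descent_of_representation` (LH3-p01 (g5)): the two-chart descent package `hdesc₁ ∧ hdesc₂` in ★ (JH-st-2)'s tokens (odd-ised compact reader);
* ★ (JH-asm) `exists_jumpConst_stOrbFamH_of_twoChartDescent` (this seat, p851426): ONE `Jc = (I·K₀)∕(K₀′·C∕C′) · 2κ₀ ≠ 0` BEFORE `fH` serving ★ (π)'s `G`-semiregular clause for every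
  `fH`, all orders, all adapted words (★ (JH-st-1)(JH-st-2) p851391∕p851397 inside) = the socket `hsemi` at `(S, w₀)`;
* ★ (JH-E) `exists_archBouazizSpaceH_stOrbFamH` (this seat, p851367): `hsemi` ⇒ ONE `jcH ≠ 0` with `ArchBouazizSpaceH jcH (stOrbFamH L νH fH)` for every `fH` ((π) propagation to
  every semiregular wall point + (P)(W)(I₁)(I₂)(I₄) ★).
HEADS: `hsemi_stOrbFamH` (the socket, ★ p851279's product-of-Borel frame), `exists_archBzJump_stOrbFamH_paid`, `exists_archBouazizSpaceH_stOrbFamH_paid` (same frame), and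
**`exists_archBouazizSpaceH_stOrbFamH_leaf`** (LEAF frame, transported along `Prod.borelSpace` as in ★ p851367 §3).  HONEST LABEL: count-neutral until the leaf's v10 cut consumes it;
the SURJECTIVE half `BouazizSurjOfForwardStatement` (LH10 board) and the other organs of `stub_N9` remain; HC_CM is proved only modulo the 7 printed citations (2 remaining:
hLiu418 = stmt-HodgeConjecture-24832, h413 = stmt-HodgeConjecture-24833) until rung 0 closes.

## References
* [Bouaziz1994IntegralesOrbitales] A. Bouaziz, *Intégrales orbitales sur les groupes de Lie réductifs*, Ann. Sci. ÉNS (4) 27 (1994) 573–609: §3.2 (I₃) p. 580; §6.2 p. 591, Thm. 6.2.1 (i).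
* [Shelstad1979] D. Shelstad, *Characters and inner forms of a quasi-split group over ℝ*, Compositio Math. 39 (1979) 11–45: §4 pp. 22–25, Lemma 4.3 p. 25, Prop. 4.5 p. 26, Thm. 4.7 (IIIb) p. 31.
* [Varadarajan1977] V. S. Varadarajan, *Harmonic Analysis on Real Reductive Groups*, LNM 576 (1977), Part I §1.12.
* [Varadarajan1989] V. S. Varadarajan, *An Introduction to Harmonic Analysis on Semisimple Lie Groups*, Cambridge Stud. Adv. Math. 16 (1989), §6.4 Lemma 21, Thms 23–24.
-/

set_option autoImplicit false

noncomputable section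

open Set Filter Function Complex MeasureTheory Measure NumberField NumberField.InfinitePlace Topology
open scoped Topology ContDiff MatrixGroups Matrix.Norms.Operator NNReal ENNReal Classical
open Literature.NumberTheory.Automorphic Literature.NumberTheory.Automorphic.UnitaryGroup Literature.NumberTheory.Automorphic.ArchCartan
open Literature.NumberTheory.Automorphic.Shelstad1979.StableOrbitalIntegrals Literature.Analysis.Calculus

namespace Literature.NumberTheory.Rogawski1990

local notation3 "Φ₂[" L "]" => (Matrix.of fun i j : Fin 2 => if i.val + j.val + 1 = 2 then (1 : L) else 0)

open Literature.MeasureTheory.Group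

section Payer

variable (L : Type) [Field L] [NumberField L] [IsCMField L]
  [∀ w : {w : InfinitePlace L // IsComplex w}, MeasurableSpace ↥(archLocal L 2 Φ₂[L] w)]
  [∀ w : {w : InfinitePlace L // IsComplex w}, BorelSpace ↥(archLocal L 2 Φ₂[L] w)]
  [MeasurableSpace ↥(arch (↥(maximalRealSubfield L)) L (IsCMField.complexConj L) 2 Φ₂[L])] [BorelSpace ↥(arch (↥(maximalRealSubfield L)) L (IsCMField.complexConj L) 2 Φ₂[L])]
  [MeasurableSpace ↥(arch (↥(maximalRealSubfield L)) L (IsCMField.complexConj L) 1 (Matrix.of fun i j : Fin 1 => if i.val + j.val + 1 = 1 then (1 : L) else 0))]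
  [BorelSpace ↥(arch (↥(maximalRealSubfield L)) L (IsCMField.complexConj L) 1 (Matrix.of fun i j : Fin 1 => if i.val + j.val + 1 = 1 then (1 : L) else 0))]
  (νH : Measure (↥(arch (↥(maximalRealSubfield L)) L (IsCMField.complexConj L) 2 Φ₂[L]) ×
      ↥(arch (↥(maximalRealSubfield L)) L (IsCMField.complexConj L) 1 (Matrix.of fun i j : Fin 1 => if i.val + j.val + 1 = 1 then (1 : L) else 0))))
  [νH.IsHaarMeasure] [νH.IsMulRightInvariant]

set_option maxHeartbeats 1600000 in
/-- **THE SOCKET `hsemi` OF ★ (JH-E), PAID** (★ p851279 product-of-Borel frame): at every wall `(S, w₀)`, `w₀ ∉ S`, ONE constant `J ≠ 0`, chosen before the test function, serving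
★ (π)'s `G`-semiregular jump clause for `stOrbFamH L νH fH`, EVERY `fH ∈ C_c^∞(H_∞)`, all orders, all adapted words — the (J)-H chain of the module docstring, assembled.
[cite: Bouaziz1994IntegralesOrbitales, §3.2 (I₃) p. 580; §6.2 p. 591] [cite: Shelstad1979, Lemma 4.3 (p. 25), Prop. 4.5 (p. 26), Thm. 4.7 (IIIb) (p. 31)] [cite: Varadarajan1989, §6.4 Thm 23] -/
theorem hsemi_stOrbFamH (S : Finset {w : InfinitePlace L // IsComplex w}) (w₀ : {w : InfinitePlace L // IsComplex w}) (hw₀ : w₀ ∉ S) :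
    ∃ J : ℂ, J ≠ 0 ∧
      ∀ fH : ↥(arch (↥(maximalRealSubfield L)) L (IsCMField.complexConj L) 2 Φ₂[L]) ×
          ↥(arch (↥(maximalRealSubfield L)) L (IsCMField.complexConj L) 1 (Matrix.of fun i j : Fin 1 => if i.val + j.val + 1 = 1 then (1 : L) else 0)) → ℂ,
        ArchSmooth₂ L fH →
        ∀ p : {w : InfinitePlace L // IsComplex w} → Fin 3 → ℝ, p w₀ 0 = p w₀ 2 →
        Circle.exp (p w₀ 1) ≠ Circle.exp (p w₀ 0) →
        (∀ v, v ∉ S → v ≠ w₀ → Function.Injective fun i : Fin 3 => Circle.exp (p v i)) →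
        (∀ v ∈ S, p v 0 ≠ 0) →
        ∀ (n : ℕ) (m : Fin n → {w : InfinitePlace L // IsComplex w} × Fin 3),
          HasOneSidedJump (fun ν : ℝ => bzTwistedDeriv S n (fun j => bzAdaptedVec w₀ (m j)) (stOrbFamH L νH fH S) (p + ν • nrm w₀))
            (J * bzCayScalar w₀ m * bzTwistedDeriv (insert w₀ S) n (fun j => bzCayVec (m j)) (stOrbFamH L νH fH (insert w₀ S)) (cayPt w₀ p)) := by
  haveI : Fact (0 < 2 * Real.pi) := ⟨Real.two_pi_pos⟩
  -- the rank-one carrier `U(σ_{w₀}Φ₂) = archLocal L 2 Φ₂ w₀`, in ★ 2b∕4d's `J`-tokens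
  have hJ : Matrix.map Φ₂[L] w₀.1.embedding = (StdForm.antidiagonal 2).over ℂ := by rw [antidiagOne_map, StdForm.over_antidiagonal_eq]
  letI jM : MeasurableSpace ↥(unitaryGroupOfForm (starRingEnd ℂ) (Matrix.map Φ₂[L] w₀.1.embedding)) := inferInstanceAs (MeasurableSpace ↥(archLocal L 2 Φ₂[L] w₀))
  haveI jB : BorelSpace ↥(unitaryGroupOfForm (starRingEnd ℂ) (Matrix.map Φ₂[L] w₀.1.embedding)) := inferInstanceAs (BorelSpace ↥(archLocal L 2 Φ₂[L] w₀))
  haveI jLC : LocallyCompactSpace ↥(unitaryGroupOfForm (starRingEnd ℂ) (Matrix.map Φ₂[L] w₀.1.embedding)) := locallyCompactSpace_archLocal_two L w₀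
  haveI jSC : SecondCountableTopology ↥(unitaryGroupOfForm (starRingEnd ℂ) (Matrix.map Φ₂[L] w₀.1.embedding)) := secondCountableTopology_archLocal_two L w₀
  -- ★ (JH-A-pos): measures, POSITIVE constants, the two families of leaves, the quotient identity — ALL before `fH`
  obtain ⟨νw, hνH, hνR, K₀, K₀', Λw, Λw', Zw, Zw', C', hK₀pos, hK₀'pos, hΛoff, hZoff, ⟨hΛfin, hσ, hZcl, hZnull, hexpl, hprop⟩, ⟨hΛ'fin, hσ', hZ'cl, hZ'null, hexpl', hprop'⟩,
      hC', hquot, hfam⟩ :=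
    exists_twoChart_placeLeaves_stOrbFamH_model_pos L S w₀ νH hw₀
  haveI : ∀ w, (νw w).IsHaarMeasure := hνH
  haveI : ∀ w, (νw w).IsMulRightInvariant := hνR
  haveI : ∀ w, IsFiniteMeasureOnCompacts (Λw w) := hΛfin
  haveI : ∀ w, SigmaFinite (Λw w) := hσ
  haveI : ∀ w, IsFiniteMeasureOnCompacts (Λw' w) := hΛ'fin
  haveI : ∀ w, SigmaFinite (Λw' w) := hσ'
  -- the place-`w₀` measures, read on `U(J)` (types over `jM`, values by `rfl`-unfolding of `archLocal`)
  let ν₀ : Measure ↥(unitaryGroupOfForm (starRingEnd ℂ) (Matrix.map Φ₂[L] w₀.1.embedding)) := νw w₀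
  let Λ' : Measure (↥(unitaryGroupOfForm (starRingEnd ℂ) (Matrix.map Φ₂[L] w₀.1.embedding)) × ↥(unitaryGroupOfForm (starRingEnd ℂ) (Matrix.map Φ₂[L] w₀.1.embedding))) := Λw' w₀
  haveI iν₀ : ν₀.IsHaarMeasure := hνH w₀
  haveI iν₀r : ν₀.IsMulRightInvariant := hνR w₀
  haveI iΛ' : IsFiniteMeasureOnCompacts Λ' := hΛ'fin w₀
  -- the Iwasawa datum on `U(J)`: the rotation circle `K`, its Haar measure, `μ_N` (★ FILE 1)
  obtain ⟨K, hKdef⟩ : ∃ K : Subgroup ↥(unitaryGroupOfForm (starRingEnd ℂ) (Matrix.map Φ₂[L] w₀.1.embedding)),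
      (K : Set ↥(unitaryGroupOfForm (starRingEnd ℂ) (Matrix.map Φ₂[L] w₀.1.embedding))) =
      Set.range (fun s : AddCircle (2 * Real.pi) =>
        (⟨archPlaneLiftGL 1 (rotMat s) (det_rotMat s), archPlaneLiftGL_rotMat_mem hJ s⟩ : ↥(unitaryGroupOfForm (starRingEnd ℂ) (Matrix.map Φ₂[L] w₀.1.embedding)))) :=
    ⟨{ carrier := Set.range (fun s : AddCircle (2 * Real.pi) =>
          (⟨archPlaneLiftGL 1 (rotMat s) (det_rotMat s), archPlaneLiftGL_rotMat_mem hJ s⟩ : ↥(unitaryGroupOfForm (starRingEnd ℂ) (Matrix.map Φ₂[L] w₀.1.embedding))))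
       one_mem' := ⟨0, Subtype.ext archPlaneLiftGL_rotMat_zero⟩
       mul_mem' := by
         rintro _ _ ⟨s, rfl⟩ ⟨t, rfl⟩
         exact ⟨s + t, Subtype.ext (archPlaneLiftGL_rotMat_add s t)⟩
       inv_mem' := by
         rintro _ ⟨s, rfl⟩
         exact ⟨-s, Subtype.ext (by rw [Subgroup.coe_inv]; exact archPlaneLiftGL_rotMat_neg s)⟩ }, rfl⟩
  have hKmem : ∀ s : AddCircle (2 * Real.pi),
      (⟨archPlaneLiftGL 1 (rotMat s) (det_rotMat s), archPlaneLiftGL_rotMat_mem hJ s⟩ : ↥(unitaryGroupOfForm (starRingEnd ℂ) (Matrix.map Φ₂[L] w₀.1.embedding))) ∈ K :=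
    fun s => by rw [← SetLike.mem_coe, hKdef]; exact ⟨s, rfl⟩
  have hKmem' : ∀ k ∈ K, ∃ s : AddCircle (2 * Real.pi),
      k = (⟨archPlaneLiftGL 1 (rotMat s) (det_rotMat s), archPlaneLiftGL_rotMat_mem hJ s⟩ : ↥(unitaryGroupOfForm (starRingEnd ℂ) (Matrix.map Φ₂[L] w₀.1.embedding))) :=
    fun k hk => by
    rw [← SetLike.mem_coe, hKdef] at hk
    obtain ⟨s, hs⟩ := hk
    exact ⟨s, hs.symm⟩
  have hK : IsCompact (K : Set ↥(unitaryGroupOfForm (starRingEnd ℂ) (Matrix.map Φ₂[L] w₀.1.embedding))) := by rw [hKdef]; exact isCompact_range_rotLift hJ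
  have hKB : ∀ g : ↥(unitaryGroupOfForm (starRingEnd ℂ) (Matrix.map Φ₂[L] w₀.1.embedding)), ∃ k ∈ K, ∃ b ∈ borelU (starRingEnd ℂ) (Matrix.map Φ₂[L] w₀.1.embedding), g = k * b := by
    intro g
    obtain ⟨s, b, hb, hg⟩ := exists_rotLift_mul_mem_borelU hJ g
    exact ⟨_, hKmem s, b, hb, hg⟩
  haveI : CompactSpace ↥K := isCompact_iff_compactSpace.1 hK
  haveI : BorelSpace ↥K := Subtype.borelSpace _
  obtain ⟨κK, hκK⟩ : ∃ κK : Measure ↥K, IsHaarMeasure κK := ⟨_, isHaarMeasure_map_rotLift hJ K hKmem hKmem'⟩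
  haveI := hκK
  have hNc : IsClosed ((unipotentU (starRingEnd ℂ) (Matrix.map Φ₂[L] w₀.1.embedding) : Subgroup _) : Set ↥(unitaryGroupOfForm (starRingEnd ℂ) (Matrix.map Φ₂[L] w₀.1.embedding))) :=
    LineRing.isClosed_unipotentU _ _
  haveI : LocallyCompactSpace ↥(unipotentU (starRingEnd ℂ) (Matrix.map Φ₂[L] w₀.1.embedding)) := hNc.isClosedEmbedding_subtypeVal.locallyCompactSpace
  haveI : SecondCountableTopology ↥(unipotentU (starRingEnd ℂ) (Matrix.map Φ₂[L] w₀.1.embedding)) := TopologicalSpace.Subtype.secondCountableTopology _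
  haveI : BorelSpace ↥(unipotentU (starRingEnd ℂ) (Matrix.map Φ₂[L] w₀.1.embedding)) := Subtype.borelSpace _
  obtain ⟨μN, hμN⟩ : ∃ μN : Measure ↥(unipotentU (starRingEnd ℂ) (Matrix.map Φ₂[L] w₀.1.embedding)), IsHaarMeasure μN := ⟨Measure.haar, inferInstance⟩
  haveI := hμN
  -- (JH-A′): the split leaf in half-chart currency, ONE `C ≠ 0` before the test function
  letI jMq : MeasurableSpace (↥(unitaryGroupOfForm (starRingEnd ℂ) (Matrix.map Φ₂[L] w₀.1.embedding)) ⧸ chartTorusHLoc L (insert w₀ S) w₀) := borel _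
  haveI jBq : BorelSpace (↥(unitaryGroupOfForm (starRingEnd ℂ) (Matrix.map Φ₂[L] w₀.1.embedding)) ⧸ chartTorusHLoc L (insert w₀ S) w₀) := ⟨rfl⟩
  haveI := isHaarMeasure_chartHaarHLoc L (insert w₀ S) w₀
  haveI := isInvInvariant_chartHaarHLoc L (insert w₀ S) w₀
  obtain ⟨C, hC0, hC⟩ := @UnitaryGroup.exists_integral_leaf_eq_smul_integral_halfChart _ hJ jM jB jLC jSC (chartTorusHLoc L (insert w₀ S) w₀)
    (chartTorusHLoc_eq_torusU L (insert w₀ S) (Finset.mem_insert_self w₀ S)) (isClosed_chartTorusHLoc L (insert w₀ S) w₀) jMq jBq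
    (chartHaarHLoc L (insert w₀ S) w₀) ‹_› ‹_› ν₀ iν₀ iν₀r K hK hKB κK ‹_› μN ‹_›
    (fun v : Fin 3 → ℝ => endoBlockAt L (insert w₀ S) w₀ v) (endoBlockAt_eq_mk_hypBlockGL L (insert w₀ S) (Finset.mem_insert_self w₀ S))
    (forall_mem_chartTorusHLoc_comm L (insert w₀ S) w₀) Λ' C' hC' (fun cw hcw => hquot (fun _ => cw) hcw)
  -- the readers (their defining tokens)
  obtain ⟨Φ₁, hΦ₁⟩ : ∃ Φ₁ : (Matrix (Fin 2) (Fin 2) ℂ → ℂ) → ℝ → ℂ, ∀ (f : Matrix (Fin 2) (Fin 2) ℂ → ℂ) (ψ : ℝ), Φ₁ f ψ = (2 * Real.sin ψ) •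
      ∫ h : ↥(unitaryGroupOfForm (starRingEnd ℂ) (Matrix.map Φ₂[L] w₀.1.embedding)), f (((h * ⟨Matrix.GeneralLinearGroup.mkOfDetNeZero !![(1 : ℂ), 1; 1, -1] det_cayleyTwo_ne_zero *
            circleDiagonal 2 ![1 * Circle.exp ψ, 1 * Circle.exp (-ψ)] * (Matrix.GeneralLinearGroup.mkOfDetNeZero !![(1 : ℂ), 1; 1, -1] det_cayleyTwo_ne_zero)⁻¹,
          cayley_conj_circleDiagonal_mem_of_eq_over hJ _⟩ * h⁻¹ : ↥(unitaryGroupOfForm (starRingEnd ℂ) (Matrix.map Φ₂[L] w₀.1.embedding))) : GL (Fin 2) ℂ) : Matrix (Fin 2) (Fin 2) ℂ) ∂ν₀ :=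
    ⟨fun f ψ => _, fun _ _ => rfl⟩
  obtain ⟨Φ₂, hΦ₂⟩ : ∃ Φ₂ : (Matrix (Fin 2) (Fin 2) ℂ → ℂ) → ℝ → ℂ, ∀ (f : Matrix (Fin 2) (Fin 2) ℂ → ℂ) (x : ℝ), Φ₂ f x =
      ∫ p : ↥K × ↥(unipotentU (starRingEnd ℂ) (Matrix.map Φ₂[L] w₀.1.embedding)),
      f ((((((p.1 : ↥K) : ↥(unitaryGroupOfForm (starRingEnd ℂ) (Matrix.map Φ₂[L] w₀.1.embedding))) * (((⟨hypBlockGL 0 0, hypBlockGL_mem_of_eq_over hJ 0 0⟩ : ↥(unitaryGroupOfForm (starRingEnd ℂ) (Matrix.map Φ₂[L] w₀.1.embedding)))) *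
          ((⟨hypBlockGL (x / 2) 0, hypBlockGL_mem_of_eq_over hJ (x / 2) 0⟩ : ↥(unitaryGroupOfForm (starRingEnd ℂ) (Matrix.map Φ₂[L] w₀.1.embedding)))) *
          ((p.2 : ↥(unipotentU (starRingEnd ℂ) (Matrix.map Φ₂[L] w₀.1.embedding))) : ↥(unitaryGroupOfForm (starRingEnd ℂ) (Matrix.map Φ₂[L] w₀.1.embedding))) *
          ((⟨hypBlockGL (x / 2) 0, hypBlockGL_mem_of_eq_over hJ (x / 2) 0⟩ : ↥(unitaryGroupOfForm (starRingEnd ℂ) (Matrix.map Φ₂[L] w₀.1.embedding))))) *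
          ((p.1 : ↥K) : ↥(unitaryGroupOfForm (starRingEnd ℂ) (Matrix.map Φ₂[L] w₀.1.embedding)))⁻¹ : ↥(unitaryGroupOfForm (starRingEnd ℂ) (Matrix.map Φ₂[L] w₀.1.embedding)))) : GL (Fin 2) ℂ) : Matrix (Fin 2) (Fin 2) ℂ) ∂(κK.prod μN) :=
    ⟨_, fun _ _ => rfl⟩
  -- the constants (★ (JH-A-pos): `0 < K₀`, `0 < K₀'`; ★ (JH-A′): `C ≠ 0`; ★ (JH-A): `C' ≠ 0`)
  have hK₀ : K₀ ≠ 0 := hK₀pos.ne'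
  have hK₀' : K₀' ≠ 0 := hK₀'pos.ne'
  have hK₁ : Complex.I * (K₀ : ℂ) ≠ 0 := mul_ne_zero Complex.I_ne_zero (Complex.ofReal_ne_zero.2 hK₀)
  have hK₂ : (((K₀' * ((C : ℝ) / (C' : ℝ)) : ℝ)) : ℂ) ≠ 0 := by
    have hCr : (C : ℝ) ≠ 0 := NNReal.coe_ne_zero.2 hC0
    have hC'r : (C' : ℝ) ≠ 0 := NNReal.coe_ne_zero.2 hC'
    exact_mod_cast mul_ne_zero hK₀' (div_ne_zero hCr hC'r)
  -- ★ (JH-asm) with the (JH-desc) package per test function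
  refine exists_jumpConst_stOrbFamH_of_twoChartDescent L νH S w₀ hw₀ hJ ν₀ κK μN hK hKB Φ₁ hΦ₁ Φ₂ hΦ₂
    (fun q : {w : InfinitePlace L // IsComplex w} → Fin 3 → ℝ => (∏ w ∈ Finset.univ.erase w₀, ((if w ∈ S then (1 : ℂ) else (Circle.exp (((q) w 0 - (q) w 2) / 2) : ℂ)) * (if w ∈ S then ((Real.exp ((q) w 0) : ℝ) : ℂ) else 1 - (Circle.exp ((q) w 2 - (q) w 0) : ℂ)))))
    (Complex.I * K₀) (((K₀' * ((C : ℝ) / (C' : ℝ)) : ℝ)) : ℂ) hK₁ hK₂ ?_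
  intro fH hfH p hp
  obtain ⟨⟨-, -, hcS, -⟩, ⟨-, -, hcS', -⟩⟩ := hfam hfH
  obtain ⟨Θ, hΘ, -, hΘf⟩ := hfH.exists_contDiff
  have hfc : HasCompactSupport fH := ArchSmooth₂.hasCompactSupport L hfH
  have hΨ'c : ContinuousOn (stOrbFamH L νH fH (insert w₀ S)) (InRegS (insert w₀ S)) := ((archBzSmoothBounded_stOrbFamH L νH hfH) (insert w₀ S)).1.continuousOn
  have hpreg : ∀ w, w ∉ S → w ≠ w₀ → Circle.exp (p w 0) ≠ Circle.exp (p w 2) := fun w hw hne h =>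
    absurd (hp.2.2.1 w hw hne h) (by decide)
  exact exists_twoChart_descent_of_representation L S w₀ hJ hw₀ ν₀ Φ₁ hΦ₁ κK μN hK Φ₂ hΦ₂ K₀ K₀'
    (fun c => ∫ z : ∀ w : {w : InfinitePlace L // IsComplex w}, ↥(archLocal L 2 Φ₂[L] w) × ↥(archLocal L 2 Φ₂[L] w),
      fH ((archPiEquivCM 2 L Φ₂[L]).symm (fun w => (z w).1 * (endoBlockAt L S w (c w) * (z w).2) * (z w).1⁻¹), (endoTorus L S c).2) ∂(Measure.pi Λw))
    (fun c => ∫ z : ∀ w : {w : InfinitePlace L // IsComplex w}, ↥(archLocal L 2 Φ₂[L] w) × ↥(archLocal L 2 Φ₂[L] w),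
      fH ((archPiEquivCM 2 L Φ₂[L]).symm (fun w => (z w).1 * (endoBlockAt L (insert w₀ S) w (c w) * (z w).2) * (z w).1⁻¹), (endoTorus L (insert w₀ S) c).2)
        ∂(Measure.pi Λw'))
    (stOrbFamH L νH fH S) (stOrbFamH L νH fH (insert w₀ S)) hcS hcS' hΨ'c
    (fun v : Fin 3 → ℝ => endoBlockAt L (insert w₀ S) w₀ v) Λ' (Zw' w₀) (hZ'null w₀)
    (fun U hU C'' hC'' => hprop' w₀ U hU (fun h => absurd (Finset.mem_insert_self w₀ S) h) C'' hC'')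
    (fun C₁ hC₁ hC₁reg => by
      have h := exists_wallSet_representation_twoChart L S hfc hΘ hΘf νw Λw Zw hZcl hZnull hexpl hprop hw₀ Λw' Zw' hZ'cl hZ'null hΛoff hZoff hprop' 0 hC₁ hC₁reg
      simp only [Int.cast_zero, zero_mul, sub_zero, add_zero] at h
      exact h)
    ((C : ℝ) / (C' : ℝ)) (fun Gf hGf _ c hc => hC Gf hGf (c w₀) hc) hp.1 hpreg

/-- **L3′ FORWARD HALF, PAID (★ p851279 frame)**: ONE jump datum `jcH`, non-zero at every wall, with `ArchBouazizSpaceH jcH (stOrbFamH L νH fH)` for EVERY `fH ∈ C_c^∞(H_∞)` —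
★ (JH-E) `exists_archBouazizSpaceH_stOrbFamH` on `hsemi_stOrbFamH`. [cite: Bouaziz1994IntegralesOrbitales, §6.2 p. 591, Thm. 6.2.1 (i)] [cite: Shelstad1979, Thm. 4.7 (p. 31)] -/
theorem exists_archBouazizSpaceH_stOrbFamH_paid :
    ∃ jcH : Finset {w : InfinitePlace L // IsComplex w} → {w : InfinitePlace L // IsComplex w} → ℂ,
      (∀ (S : Finset {w : InfinitePlace L // IsComplex w}) (w : {w : InfinitePlace L // IsComplex w}), w ∉ S → jcH S w ≠ 0) ∧
      ∀ fH : ↥(arch (↥(maximalRealSubfield L)) L (IsCMField.complexConj L) 2 Φ₂[L]) ×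
      ↥(arch (↥(maximalRealSubfield L)) L (IsCMField.complexConj L) 1 (Matrix.of fun i j : Fin 1 => if i.val + j.val + 1 = 1 then (1 : L) else 0)) → ℂ,
        ArchSmooth₂ L fH → ArchBouazizSpaceH jcH (stOrbFamH L νH fH) :=
  exists_archBouazizSpaceH_stOrbFamH L νH (fun S w₀ hw₀ => hsemi_stOrbFamH L νH S w₀ hw₀)

/-- **THE JUMP CLAUSE (I₃) FOR EVERY TEST FUNCTION, PAID (★ p851279 frame)**: ONE `jcH ≠ 0` with `ArchBzJump jcH (stOrbFamH L νH fH)` for every `fH ∈ C_c^∞(H_∞)`.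
[cite: Bouaziz1994IntegralesOrbitales, §3.2 (I₃) p. 580; §6.2 p. 591] [cite: Shelstad1979, Thm. 4.7 (IIIb) (p. 31)] -/
theorem exists_archBzJump_stOrbFamH_paid :
    ∃ jcH : Finset {w : InfinitePlace L // IsComplex w} → {w : InfinitePlace L // IsComplex w} → ℂ,
      (∀ (S : Finset {w : InfinitePlace L // IsComplex w}) (w : {w : InfinitePlace L // IsComplex w}), w ∉ S → jcH S w ≠ 0) ∧
      ∀ fH : ↥(arch (↥(maximalRealSubfield L)) L (IsCMField.complexConj L) 2 Φ₂[L]) ×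
      ↥(arch (↥(maximalRealSubfield L)) L (IsCMField.complexConj L) 1 (Matrix.of fun i j : Fin 1 => if i.val + j.val + 1 = 1 then (1 : L) else 0)) → ℂ,
        ArchSmooth₂ L fH → ArchBzJump jcH (stOrbFamH L νH fH) :=
  exists_archBzJump_stOrbFamH L νH (fun S w₀ hw₀ => hsemi_stOrbFamH L νH S w₀ hw₀)

end Payer

section LeafFrame

variable (L : Type) [Field L] [NumberField L] [IsCMField L]
  [MeasurableSpace (↥(arch (↥(maximalRealSubfield L)) L (IsCMField.complexConj L) 2 Φ₂[L]) ×
      ↥(arch (↥(maximalRealSubfield L)) L (IsCMField.complexConj L) 1 (Matrix.of fun i j : Fin 1 => if i.val + j.val + 1 = 1 then (1 : L) else 0)))]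
  [BorelSpace (↥(arch (↥(maximalRealSubfield L)) L (IsCMField.complexConj L) 2 Φ₂[L]) ×
      ↥(arch (↥(maximalRealSubfield L)) L (IsCMField.complexConj L) 1 (Matrix.of fun i j : Fin 1 => if i.val + j.val + 1 = 1 then (1 : L) else 0)))]
  (νH : Measure (↥(arch (↥(maximalRealSubfield L)) L (IsCMField.complexConj L) 2 Φ₂[L]) ×
      ↥(arch (↥(maximalRealSubfield L)) L (IsCMField.complexConj L) 1 (Matrix.of fun i j : Fin 1 => if i.val + j.val + 1 = 1 then (1 : L) else 0))))
  [νH.IsHaarMeasure] [νH.IsMulRightInvariant]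

/-- **L3′ FORWARD HALF IN THE LEAF FRAME = organ `BouazizForwardStatement`, PAID**: for every CM field `L` and Haar `νH` on `H_∞` (ONE Borel σ-algebra on the product), ONE jump datum
`jcH`, non-zero at every wall, with `ArchBouazizSpaceH jcH (stOrbFamH L νH fH)` for EVERY `fH ∈ C_c^∞(H_∞)` (the product-frame head transported along `Prod.borelSpace`, per-place
σ-algebras chosen Borel inside). [cite: Bouaziz1994IntegralesOrbitales, §6.2 p. 591, Thm. 6.2.1 (i)] [cite: Shelstad1979, §4 pp. 22–23; Thm. 4.7 (p. 31)] -/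
theorem exists_archBouazizSpaceH_stOrbFamH_leaf :
    ∃ jcH : Finset {w : InfinitePlace L // IsComplex w} → {w : InfinitePlace L // IsComplex w} → ℂ,
      (∀ (S : Finset {w : InfinitePlace L // IsComplex w}) (w : {w : InfinitePlace L // IsComplex w}), w ∉ S → jcH S w ≠ 0) ∧
      ∀ fH : ↥(arch (↥(maximalRealSubfield L)) L (IsCMField.complexConj L) 2 Φ₂[L]) ×
      ↥(arch (↥(maximalRealSubfield L)) L (IsCMField.complexConj L) 1 (Matrix.of fun i j : Fin 1 => if i.val + j.val + 1 = 1 then (1 : L) else 0)) → ℂ,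
        ArchSmooth₂ L fH → ArchBouazizSpaceH jcH (stOrbFamH L νH fH) := by
  letI mA : MeasurableSpace ↥(arch (↥(maximalRealSubfield L)) L (IsCMField.complexConj L) 2 Φ₂[L]) := borel _
  haveI : BorelSpace ↥(arch (↥(maximalRealSubfield L)) L (IsCMField.complexConj L) 2 Φ₂[L]) := ⟨rfl⟩
  letI mB : MeasurableSpace ↥(arch (↥(maximalRealSubfield L)) L (IsCMField.complexConj L) 1 (Matrix.of fun i j : Fin 1 => if i.val + j.val + 1 = 1 then (1 : L) else 0)) :=
    borel _
  haveI : BorelSpace ↥(arch (↥(maximalRealSubfield L)) L (IsCMField.complexConj L) 1 (Matrix.of fun i j : Fin 1 => if i.val + j.val + 1 = 1 then (1 : L) else 0)) := ⟨rfl⟩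
  letI : ∀ w : {w : InfinitePlace L // IsComplex w}, MeasurableSpace ↥(archLocal L 2 Φ₂[L] w) := fun _ => borel _
  haveI : ∀ w : {w : InfinitePlace L // IsComplex w}, BorelSpace ↥(archLocal L 2 Φ₂[L] w) := fun _ => ⟨rfl⟩
  have hmm : ‹MeasurableSpace (↥(arch (↥(maximalRealSubfield L)) L (IsCMField.complexConj L) 2 Φ₂[L]) ×
      ↥(arch (↥(maximalRealSubfield L)) L (IsCMField.complexConj L) 1 (Matrix.of fun i j : Fin 1 => if i.val + j.val + 1 = 1 then (1 : L) else 0)))› = Prod.instMeasurableSpace := by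
    rw [BorelSpace.measurable_eq (α := ↥(arch (↥(maximalRealSubfield L)) L (IsCMField.complexConj L) 2 Φ₂[L]) ×
      ↥(arch (↥(maximalRealSubfield L)) L (IsCMField.complexConj L) 1 (Matrix.of fun i j : Fin 1 => if i.val + j.val + 1 = 1 then (1 : L) else 0)))]
    exact (Prod.borelSpace.measurable_eq).symm
  subst hmm
  exact exists_archBouazizSpaceH_stOrbFamH_paid L νH

end LeafFrame

end Literature.NumberTheory.Rogawski1990

end
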